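import Mathlib.Data.Nat.Choose.Sum
import Mathlib.Data.Matrix.Basic
import Mathlib.Algebra.BigOperators.Intervals
import Summits.CriticalPhenomena.PercolationContinuityZ3.Theorems.PercNearOneGluingNoHeavyLowerTailAntiBandCoveringDet

/-!
# `NoHeavyLowerTail` (crux stmt-CriticalPhenomena-4575), lane prim-ineq-gen-4 (gen 27): the BAND FORM of the binomial matrix for every `n ≥ 2k+2`

Support file (`--supports stmt-CriticalPhenomena-4575`; memos `run/shared/lean/prim/prim-ineq-gen-4/FINDING-SPECTRAL-GAP-g26.md` §0(8) PROP 8 and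
`FINDING-OFFDIAG-UNIVERSAL-g27.md` §0(1) PROP 1).  Pure finite combinatorics / matrix algebra over `ℤ`, no definitions, no `sorry`, standard axioms.

Setting.  `|β| = K + k + 1` with `k + 1 ≤ K` (i.e. `|β| = n ≥ 2k+2`, `K = n−1−k`), `U` a family of finsets of size `≤ k` that is up-closed inside the ball,
and for each "band" level `j ∈ [k+1, K]` the incidence matrix `N_j[y,x] = [x ⊆ y]` (`y` a `j`-subset of `β`, `x ∈ U`).  With `Z[z,x] = [x ⊆ z]` (`z, x ∈ U`) and
`S' = diag (−1)^{K − #z}`: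
`∑_{j=k+1}^{K} (−1)^{K−j} N_jᵀ N_j + Zᵀ S' Z = [C(|β|−1−#(x∪x'), k)]_{x,x'∈U}`
— the binomial matrix `M_U` of the determinant criterion (g21) is a unitriangular congruence of the signature matrix `S'` plus a SIGNED sum of Grams of the
band-level incidence vectors.  At the diagonal `K = k+1` (one band level = the middle level) this is the middle-level form of gen 26
(`AntiBandMiddleLevel.gram_sub_zeta_sign_zeta_eq_binomial`).  Entrywise it is the truncated alternating sum
`∑_{j=s}^{K} (−1)^{K−j} C(|β|−s, j−s) = C(|β|−1−s, K−s) = C(|β|−1−s, k)` (`s = #(x∪x')`) split at `j = k` (below `k`: the members of `U` above `x ∪ x'`, by up-closure).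
Consequence (memo): `M_U` is congruent to the principal submatrix on `U` of ONE fixed `S_n`-invariant matrix `S' + Wᵀ𝔖W`, and `|det M_U| = |det(𝔖 + 𝒯_U)|` on the band.

Main statement: `band_gram_sum_add_zeta_sign_zeta_eq_binomial`.
-/

namespace Summit.CriticalPhenomena.PercolationContinuityZ3.Theorems.AntiBandBandForm

open Finset Matrix

variable {β : Type*} [DecidableEq β] [Fintype β]

/-! The four counting lemmas below are local (private) copies of the corresponding lemmas of `AntiBandMiddleLevel` (gen 26, p371632), repeated here so that this file
does not depend on that module. -/

omit [DecidableEq β] [Fintype β] in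
/-- `(−1)^(a−b) = (−1)^a (−1)^b` for `b ≤ a`. [elementary; local copy of `neg_one_pow_sub_eq_mul`] -/
private theorem neg_one_pow_sub_eq_mul (a b : ℕ) (h : b ≤ a) : (-1 : ℤ) ^ (a - b) = (-1 : ℤ) ^ a * (-1 : ℤ) ^ b := by
  obtain ⟨c, rfl⟩ := Nat.exists_eq_add_of_le h
  rw [Nat.add_sub_cancel_left, pow_add, mul_comm ((-1 : ℤ) ^ b), mul_assoc, ← pow_add, ← two_mul, pow_mul]
  simp

/-- The number of `m`-subsets of `β` containing a fixed finset `w` with `#w ≤ m` is `C(|β| − #w, m − #w)`. [elementary] -/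
private theorem card_filter_powersetCard_superset (w : Finset β) (m : ℕ) (hw : #w ≤ m) :
    #(((univ : Finset β).powersetCard m).filter (fun y => w ⊆ y)) = (Fintype.card β - #w).choose (m - #w) := by
  rw [← Finset.card_compl w, ← Finset.card_powersetCard (m - #w) wᶜ]
  symm
  apply Finset.card_bij' (fun u _ => u ∪ w) (fun y _ => y \ w)
  · intro u hu
    rw [mem_powersetCard] at hu
    have hdisj : Disjoint u w := by
      rw [← Finset.subset_compl_iff_disjoint_right]; exact hu.1
    rw [mem_filter, mem_powersetCard]
    refine ⟨⟨subset_univ _, ?_⟩, subset_union_right⟩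
    rw [card_union_of_disjoint hdisj, hu.2]
    omega
  · intro y hy
    rw [mem_filter, mem_powersetCard] at hy
    rw [mem_powersetCard]
    refine ⟨?_, ?_⟩
    · intro a ha
      rw [mem_sdiff] at ha
      rw [mem_compl]
      exact ha.2
    · rw [card_sdiff_of_subset hy.2, hy.1.2]
  · intro u hu
    rw [mem_powersetCard] at hu
    have hdisj : Disjoint u w := by
      rw [← Finset.subset_compl_iff_disjoint_right]; exact hu.1
    exact Finset.union_sdiff_cancel_right hdisj
  · intro y hy
    rw [mem_filter] at hy
    exact Finset.sdiff_union_of_subset hy.2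

/-- No `m`-subset contains a finset with more than `m` elements. [elementary] -/
private theorem filter_powersetCard_superset_eq_empty (w : Finset β) (m : ℕ) (hw : m < #w) :
    ((univ : Finset β).powersetCard m).filter (fun y => w ⊆ y) = ∅ := by
  rw [Finset.filter_eq_empty_iff]
  intro y hy hwy
  rw [mem_powersetCard] at hy
  have := Finset.card_le_card hwy
  omega

/-- Up-closure inside the ball: for `x ∈ U` and `w ⊇ x` with `#w ≤ k`, `∑_{z ∈ U, w ⊆ z} (−1)^{k − #z} = C(|β| − 1 − #w, k − #w)`
(the members of `U` above `w` are all sets `w ⊔ u`, `u ⊆ wᶜ`, `#u ≤ k − #w`; then the truncated alternating sum of g21's file). [memo PROP 1] -/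
private theorem sum_filter_superset_neg_one_pow (k : ℕ) (U : Finset (Finset β)) (hUk : ∀ z ∈ U, #z ≤ k)
    (hup : ∀ x ∈ U, ∀ z : Finset β, x ⊆ z → #z ≤ k → z ∈ U) (x w : Finset β) (hx : x ∈ U) (hxw : x ⊆ w) (hwk : #w ≤ k)
    (hβ : #w < Fintype.card β) :
    ∑ z ∈ U.filter (fun z => w ⊆ z), (-1 : ℤ) ^ (k - #z) = ((Fintype.card β - 1 - #w).choose (k - #w) : ℤ) := by
  have hne : (wᶜ : Finset β).Nonempty := by
    rw [← Finset.card_pos, Finset.card_compl]; omega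
  have key : ∑ z ∈ U.filter (fun z => w ⊆ z), (-1 : ℤ) ^ (k - #z)
      = ∑ u ∈ (wᶜ : Finset β).powerset.filter (fun u => #u ≤ k - #w), (-1 : ℤ) ^ (k - #w) * (-1 : ℤ) ^ #u := by
    apply Finset.sum_bij' (fun z _ => z \ w) (fun u _ => u ∪ w)
    · intro z hz
      rw [mem_filter] at hz
      rw [mem_filter, mem_powerset]
      refine ⟨?_, ?_⟩
      · intro a ha
        rw [mem_sdiff] at ha
        rw [mem_compl]
        exact ha.2
      · rw [card_sdiff_of_subset hz.2]
        have := hUk z hz.1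
        omega
    · intro u hu
      rw [mem_filter, mem_powerset] at hu
      have hdisj : Disjoint u w := by
        rw [← Finset.subset_compl_iff_disjoint_right]; exact hu.1
      have hcard : #(u ∪ w) = #u + #w := card_union_of_disjoint hdisj
      rw [mem_filter]
      refine ⟨hup x hx (u ∪ w) (hxw.trans subset_union_right) (by omega), subset_union_right⟩
    · intro z hz
      rw [mem_filter] at hz
      exact Finset.sdiff_union_of_subset hz.2
    · intro u hu
      rw [mem_filter, mem_powerset] at hu
      have hdisj : Disjoint u w := by
        rw [← Finset.subset_compl_iff_disjoint_right]; exact hu.1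
      exact Finset.union_sdiff_cancel_right hdisj
    · intro z hz
      rw [mem_filter] at hz
      have hzk := hUk z hz.1
      have hcard : #(z \ w) = #z - #w := card_sdiff_of_subset hz.2
      have hwz : #w ≤ #z := Finset.card_le_card hz.2
      rw [hcard]
      have h1 : k - #z = (k - #w) - (#z - #w) := by omega
      rw [h1, neg_one_pow_sub_eq_mul _ _ (by omega)]
  rw [key, ← Finset.mul_sum,
    Summit.CriticalPhenomena.PercolationContinuityZ3.Theorems.AntiBandCoveringDet.sum_neg_one_pow_powerset_card_le _ _ hne,
    ← mul_assoc, ← pow_add, ← two_mul, pow_mul]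
  simp only [neg_one_sq, one_pow, one_mul, Finset.card_compl]
  congr 2
  omega

omit [DecidableEq β] [Fintype β] in
/-- Truncated alternating binomial sum: `∑_{i ≤ m} (−1)^{m−i} C(M+1, i) = C(M, m)`. [elementary; from Mathlib's
`Int.alternating_sum_range_choose_eq_choose`] -/
theorem sum_range_neg_one_pow_sub_mul_choose (M m : ℕ) :
    ∑ i ∈ range (m + 1), (-1 : ℤ) ^ (m - i) * ((M + 1).choose i : ℤ) = (M.choose m : ℤ) := by
  have h := Int.alternating_sum_range_choose_eq_choose (n := M) (m := m)
  have h2 : ∑ i ∈ range (m + 1), (-1 : ℤ) ^ (m - i) * ((M + 1).choose i : ℤ)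
      = (-1 : ℤ) ^ m * ∑ i ∈ range (m + 1), ((-1 : ℤ) ^ i * ((M + 1).choose i : ℤ)) := by
    rw [Finset.mul_sum]
    apply Finset.sum_congr rfl
    intro i hi
    rw [mem_range] at hi
    rw [← mul_assoc, neg_one_pow_sub_eq_mul m i (by omega)]
  rw [h2, h, ← mul_assoc, ← pow_add, ← two_mul, pow_mul]
  simp

omit [DecidableEq β] [Fintype β] in
/-- Shifted truncated alternating sum over an interval: for `s ≤ b`,
`∑_{j ∈ [s, b]} (−1)^{b−j} C(M+1, j−s) = C(M, b−s)`. [elementary] -/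
theorem sum_Icc_neg_one_pow_sub_mul_choose (M s b : ℕ) (hsb : s ≤ b) :
    ∑ j ∈ Icc s b, (-1 : ℤ) ^ (b - j) * ((M + 1).choose (j - s) : ℤ) = (M.choose (b - s) : ℤ) := by
  rw [← Finset.Ico_add_one_right_eq_Icc, Finset.sum_Ico_eq_sum_range]
  have e : b + 1 - s = (b - s) + 1 := by omega
  rw [e, ← sum_range_neg_one_pow_sub_mul_choose M (b - s)]
  apply Finset.sum_congr rfl
  intro i hi
  rw [mem_range] at hi
  rw [Nat.add_sub_cancel_left, show b - (s + i) = b - s - i from by omega]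

omit [DecidableEq β] [Fintype β] in
/-- The arithmetic heart of the band form: for `k+1 ≤ K`, `s ≤ 2k`,
`∑_{j=k+1}^{K} (−1)^{K−j}·[s ≤ j]·C(K+k+1−s, j−s) + [s ≤ k]·(−1)^{K−k}·C(K+k−s, k−s) = C(K+k−s, k)`. [elementary] -/
theorem band_alternating_identity (k K s : ℕ) (hkK : k + 1 ≤ K) (hs : s ≤ 2 * k) :
    (∑ j ∈ Icc (k + 1) K, (-1 : ℤ) ^ (K - j) * (if s ≤ j then ((K + k + 1 - s).choose (j - s) : ℤ) else 0))
      + (if s ≤ k then (-1 : ℤ) ^ (K - k) * ((K + k - s).choose (k - s) : ℤ) else 0)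
      = ((K + k - s).choose k : ℤ) := by
  by_cases hsk : s ≤ k
  · -- full interval [s, K] splits at k
    rw [if_pos hsk]
    have hM : K + k + 1 - s = (K + k - s) + 1 := by omega
    have hfull := sum_Icc_neg_one_pow_sub_mul_choose (K + k - s) s K (by omega)
    have hlow := sum_Icc_neg_one_pow_sub_mul_choose (K + k - s) s k hsk
    -- split [s, K] = [s, k] ∪ [k+1, K]
    have hsplit : ∑ j ∈ Icc s K, (-1 : ℤ) ^ (K - j) * (((K + k - s) + 1).choose (j - s) : ℤ)
        = ∑ j ∈ Icc s k, (-1 : ℤ) ^ (K - j) * (((K + k - s) + 1).choose (j - s) : ℤ)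
          + ∑ j ∈ Icc (k + 1) K, (-1 : ℤ) ^ (K - j) * (((K + k - s) + 1).choose (j - s) : ℤ) := by
      rw [← Finset.Ico_add_one_right_eq_Icc, ← Finset.Ico_add_one_right_eq_Icc, ← Finset.Ico_add_one_right_eq_Icc]
      exact (Finset.sum_Ico_consecutive _ (by omega : s ≤ k + 1) (by omega : k + 1 ≤ K + 1)).symm
    have hlow' : ∑ j ∈ Icc s k, (-1 : ℤ) ^ (K - j) * (((K + k - s) + 1).choose (j - s) : ℤ)
        = (-1 : ℤ) ^ (K - k) * ((K + k - s).choose (k - s) : ℤ) := by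
      rw [← hlow, Finset.mul_sum]
      apply Finset.sum_congr rfl
      intro j hj
      rw [mem_Icc] at hj
      rw [← mul_assoc]
      congr 1
      have e : K - j = (K - k) + (k - j) := by omega
      rw [e, pow_add]
    have hband : ∑ j ∈ Icc (k + 1) K, (-1 : ℤ) ^ (K - j) * (if s ≤ j then ((K + k + 1 - s).choose (j - s) : ℤ) else 0)
        = ∑ j ∈ Icc (k + 1) K, (-1 : ℤ) ^ (K - j) * (((K + k - s) + 1).choose (j - s) : ℤ) := by
      apply Finset.sum_congr rfl
      intro j hj
      rw [mem_Icc] at hj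
      rw [if_pos (by omega), hM]
    rw [hband, ← hlow', add_comm, ← hsplit, hfull]
    congr 1
    exact Nat.choose_symm_of_eq_add (by omega)
  · rw [if_neg hsk, add_zero]
    rw [not_le] at hsk
    by_cases hsK : s ≤ K
    · -- the indicator truncates [k+1, K] to [s, K]
      have hM : K + k + 1 - s = (K + k - s) + 1 := by omega
      have hfull := sum_Icc_neg_one_pow_sub_mul_choose (K + k - s) s K hsK
      have hsplit : ∑ j ∈ Icc (k + 1) K, (-1 : ℤ) ^ (K - j) * (if s ≤ j then ((K + k + 1 - s).choose (j - s) : ℤ) else 0)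
          = ∑ j ∈ Icc (k + 1) (s - 1), (-1 : ℤ) ^ (K - j) * (if s ≤ j then ((K + k + 1 - s).choose (j - s) : ℤ) else 0)
            + ∑ j ∈ Icc s K, (-1 : ℤ) ^ (K - j) * (if s ≤ j then ((K + k + 1 - s).choose (j - s) : ℤ) else 0) := by
        rw [← Finset.Ico_add_one_right_eq_Icc, ← Finset.Ico_add_one_right_eq_Icc, ← Finset.Ico_add_one_right_eq_Icc,
          show s - 1 + 1 = s by omega]
        exact (Finset.sum_Ico_consecutive _ (by omega : k + 1 ≤ s) (by omega : s ≤ K + 1)).symm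
      have hzero : ∑ j ∈ Icc (k + 1) (s - 1), (-1 : ℤ) ^ (K - j) * (if s ≤ j then ((K + k + 1 - s).choose (j - s) : ℤ) else 0) = 0 := by
        apply Finset.sum_eq_zero
        intro j hj
        rw [mem_Icc] at hj
        rw [if_neg (by omega), mul_zero]
      have hrest : ∑ j ∈ Icc s K, (-1 : ℤ) ^ (K - j) * (if s ≤ j then ((K + k + 1 - s).choose (j - s) : ℤ) else 0)
          = ∑ j ∈ Icc s K, (-1 : ℤ) ^ (K - j) * (((K + k - s) + 1).choose (j - s) : ℤ) := by
        apply Finset.sum_congr rfl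
        intro j hj
        rw [mem_Icc] at hj
        rw [if_pos hj.1, hM]
      rw [hsplit, hzero, zero_add, hrest, hfull]
      congr 1
      exact Nat.choose_symm_of_eq_add (by omega)
    · -- everything vanishes
      rw [not_le] at hsK
      have hzero : ∑ j ∈ Icc (k + 1) K, (-1 : ℤ) ^ (K - j) * (if s ≤ j then ((K + k + 1 - s).choose (j - s) : ℤ) else 0) = 0 := by
        apply Finset.sum_eq_zero
        intro j hj
        rw [mem_Icc] at hj
        rw [if_neg (by omega), mul_zero]
      rw [hzero, Nat.choose_eq_zero_of_lt (by omega), Nat.cast_zero]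

/-- THE BAND FORM (memos g26 PROP 8, g27 PROP 1).  `|β| = K + k + 1`, `k + 1 ≤ K`, `U` up-closed inside the ball of radius `k`.  With
`N_j[y,x] = [x ⊆ y]` (`y` a `j`-subset), `Z[z,x] = [x ⊆ z]`, `S' = diag (−1)^{K−#z}`:
`∑_{j ∈ [k+1, K]} (−1)^{K−j} N_jᵀ N_j + Zᵀ S' Z = [C(K + k − #(x∪x'), k)]_{x,x' ∈ U}` (note `K + k = |β| − 1`).
Hence `M_U` is congruent (by the unitriangular `Z` and signs) to `S'_U + (Wᵀ𝔖W)_U`, a principal submatrix of one fixed invariant matrix, and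
`|det M_U| = |det(𝔖 + 𝒯_U)|` for the band operator `𝒯_U` (push-through). -/
theorem band_gram_sum_add_zeta_sign_zeta_eq_binomial (k K : ℕ) (hkK : k + 1 ≤ K) (hβ : Fintype.card β = K + k + 1)
    (U : Finset (Finset β)) (hUk : ∀ x ∈ U, #x ≤ k) (hup : ∀ x ∈ U, ∀ z : Finset β, x ⊆ z → #z ≤ k → z ∈ U) :
    (∑ j ∈ Icc (k + 1) K, (-1 : ℤ) ^ (K - j) •
        ((Matrix.of fun (y : ↥((univ : Finset β).powersetCard j)) (x : ↥U) => if (x : Finset β) ⊆ y then (1 : ℤ) else 0)ᵀ *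
          (Matrix.of fun (y : ↥((univ : Finset β).powersetCard j)) (x : ↥U) => if (x : Finset β) ⊆ y then (1 : ℤ) else 0)))
      + (Matrix.of fun (z x : ↥U) => if (x : Finset β) ⊆ z then (1 : ℤ) else 0)ᵀ *
          (Matrix.diagonal fun (z : ↥U) => (-1 : ℤ) ^ (K - #(z : Finset β))) *
          (Matrix.of fun (z x : ↥U) => if (x : Finset β) ⊆ z then (1 : ℤ) else 0)
      = Matrix.of fun (x x' : ↥U) => ((K + k - #((x : Finset β) ∪ x')).choose k : ℤ) := by
  ext x x'
  rw [Matrix.add_apply, Matrix.mul_apply, Matrix.of_apply]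
  simp only [Matrix.mul_diagonal]
  simp only [Matrix.sum_apply, Matrix.smul_apply, Matrix.mul_apply, transpose_apply, of_apply, smul_eq_mul]
  set w : Finset β := (x : Finset β) ∪ x' with hwdef
  have hwle : #w ≤ 2 * k :=
    (Finset.card_union_le _ _).trans (by have := hUk x x.2; have := hUk x' x'.2; omega)
  -- the Gram terms: number of `j`-sets above `w`
  have hV : ∀ j : ℕ, ∑ y : ↥((univ : Finset β).powersetCard j), ((if (x : Finset β) ⊆ (y : Finset β) then (1 : ℤ) else 0) *
        (if (x' : Finset β) ⊆ (y : Finset β) then (1 : ℤ) else 0))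
      = (#(((univ : Finset β).powersetCard j).filter (fun y => w ⊆ y)) : ℤ) := by
    intro j
    set Y : Finset (Finset β) := (univ : Finset β).powersetCard j with hYdef
    have h1 : ∑ y : ↥Y, ((if (x : Finset β) ⊆ (y : Finset β) then (1 : ℤ) else 0) *
          (if (x' : Finset β) ⊆ (y : Finset β) then (1 : ℤ) else 0))
        = ∑ y ∈ Y, (if w ⊆ y then (1 : ℤ) else 0) := by
      rw [univ_eq_attach, Finset.sum_attach Y (fun y => (if (x : Finset β) ⊆ y then (1 : ℤ) else 0) *
        (if (x' : Finset β) ⊆ y then (1 : ℤ) else 0))]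
      apply Finset.sum_congr rfl
      intro y _
      have hiff : w ⊆ y ↔ (x : Finset β) ⊆ y ∧ (x' : Finset β) ⊆ y := by rw [hwdef, Finset.union_subset_iff]
      by_cases h1 : (x : Finset β) ⊆ (y : Finset β) <;> by_cases h2 : (x' : Finset β) ⊆ (y : Finset β)
      · have h3 : w ⊆ y := hiff.2 ⟨h1, h2⟩
        simp [h1, h2, h3]
      · have h3 : ¬ w ⊆ y := fun h => h2 (hiff.1 h).2
        simp [h1, h2, h3]
      · have h3 : ¬ w ⊆ y := fun h => h1 (hiff.1 h).1
        simp [h1, h2, h3]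
      · have h3 : ¬ w ⊆ y := fun h => h1 (hiff.1 h).1
        simp [h1, h2, h3]
    rw [h1, Finset.sum_boole, Nat.cast_inj]
  have hV' : ∀ j : ℕ, (#(((univ : Finset β).powersetCard j).filter (fun y => w ⊆ y)) : ℤ)
      = if #w ≤ j then ((K + k + 1 - #w).choose (j - #w) : ℤ) else 0 := by
    intro j
    by_cases hj : #w ≤ j
    · rw [if_pos hj, card_filter_powersetCard_superset w j hj, hβ]
    · rw [if_neg hj, filter_powersetCard_superset_eq_empty w j (by omega), Finset.card_empty, Nat.cast_zero]
  -- the signature term: supersets of `w` inside `U`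
  have hZ : ∑ z : ↥U, ((if (x : Finset β) ⊆ (z : Finset β) then (1 : ℤ) else 0) * (-1 : ℤ) ^ (K - #(z : Finset β)) *
        (if (x' : Finset β) ⊆ (z : Finset β) then (1 : ℤ) else 0))
      = ∑ z ∈ U.filter (fun z => w ⊆ z), (-1 : ℤ) ^ (K - #z) := by
    have h1 : ∑ z : ↥U, ((if (x : Finset β) ⊆ (z : Finset β) then (1 : ℤ) else 0) * (-1 : ℤ) ^ (K - #(z : Finset β)) *
          (if (x' : Finset β) ⊆ (z : Finset β) then (1 : ℤ) else 0))
        = ∑ z ∈ U, (if w ⊆ z then (-1 : ℤ) ^ (K - #z) else 0) := by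
      rw [univ_eq_attach, Finset.sum_attach U (fun z => (if (x : Finset β) ⊆ z then (1 : ℤ) else 0) * (-1 : ℤ) ^ (K - #z) *
        (if (x' : Finset β) ⊆ z then (1 : ℤ) else 0))]
      apply Finset.sum_congr rfl
      intro z _
      have hiff : w ⊆ z ↔ (x : Finset β) ⊆ z ∧ (x' : Finset β) ⊆ z := by rw [hwdef, Finset.union_subset_iff]
      by_cases h1 : (x : Finset β) ⊆ (z : Finset β) <;> by_cases h2 : (x' : Finset β) ⊆ (z : Finset β)
      · have h3 : w ⊆ z := hiff.2 ⟨h1, h2⟩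
        simp [h1, h2, h3]
      · have h3 : ¬ w ⊆ z := fun h => h2 (hiff.1 h).2
        simp [h1, h2, h3]
      · have h3 : ¬ w ⊆ z := fun h => h1 (hiff.1 h).1
        simp [h1, h2, h3]
      · have h3 : ¬ w ⊆ z := fun h => h1 (hiff.1 h).1
        simp [h1, h2, h3]
    rw [h1, Finset.sum_filter]
  have hZ' : ∑ z ∈ U.filter (fun z => w ⊆ z), (-1 : ℤ) ^ (K - #z)
      = if #w ≤ k then (-1 : ℤ) ^ (K - k) * ((K + k - #w).choose (k - #w) : ℤ) else 0 := by
    by_cases hwk : #w ≤ k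
    · rw [if_pos hwk]
      have h2 : ∑ z ∈ U.filter (fun z => w ⊆ z), (-1 : ℤ) ^ (K - #z)
          = (-1 : ℤ) ^ (K - k) * ∑ z ∈ U.filter (fun z => w ⊆ z), (-1 : ℤ) ^ (k - #z) := by
        rw [Finset.mul_sum]
        apply Finset.sum_congr rfl
        intro z hz
        rw [mem_filter] at hz
        have hzk := hUk z hz.1
        have e : K - #z = (K - k) + (k - #z) := by omega
        rw [e, pow_add]
      rw [h2, sum_filter_superset_neg_one_pow k U hUk hup (x : Finset β) w x.2 subset_union_left hwk (by omega), hβ,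
        show K + k + 1 - 1 - #w = K + k - #w from by omega]
    · rw [if_neg hwk]
      have hZ0 : U.filter (fun z => w ⊆ z) = ∅ := by
        rw [Finset.filter_eq_empty_iff]
        intro z hz hwz
        have := Finset.card_le_card hwz
        have := hUk z hz
        omega
      rw [hZ0, Finset.sum_empty]
  have hsum : ∑ j ∈ Icc (k + 1) K, (-1 : ℤ) ^ (K - j) * ∑ y : ↥((univ : Finset β).powersetCard j),
        ((if (x : Finset β) ⊆ (y : Finset β) then (1 : ℤ) else 0) * (if (x' : Finset β) ⊆ (y : Finset β) then (1 : ℤ) else 0))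
      = ∑ j ∈ Icc (k + 1) K, (-1 : ℤ) ^ (K - j) * (if #w ≤ j then ((K + k + 1 - #w).choose (j - #w) : ℤ) else 0) := by
    apply Finset.sum_congr rfl
    intro j _
    rw [hV j, hV' j]
  rw [hsum, hZ, hZ']
  exact band_alternating_identity k K #w hkK hwle

end Summit.CriticalPhenomena.PercolationContinuityZ3.Theorems.AntiBandBandForm
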